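import Summits.ResolutionOfSingularities.ResolutionOfSingularities.Theorems.HilbertSamuelEliminationCampaignW42RidgeDimMonotone
import HarnessLib

/-!
# [OURS · L1 W4.2] CJS Thm. 3.10 (4) AT PERFECT COEFFICIENT FIELDS, UNCONDITIONALLY: `e_{x'}(X')_K + tr.deg(κ(x')/κ(x)) ≤ e_x(X)_K`
# at every near point of a permissible blow-up, for every PERFECT field `K` over the residue fields (campaign s42, cell
# res-hironaka; informal crux `RidgeConfinement`, stmt-ResolutionOfSingularities-17845; `--supports`)

HONEST FRAMING. OURS (slot W4.2, prover res-L1-s42-pv-1, gen 5). The tree's named fact `CossartJannsenSaito2020_thm_3_10_4`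
(`Literature/…/PermissibleBlowupDirectrix.lean`; CJS LNM 2270 Thm. 3.10 (4), proved there from Hironaka's *Certain numerical characters*
(1967) Thm. (1,A)) asserts the directrix inequality for EVERY field `K ⊇ κ(x')`. For PERFECT `K` (in particular `K = κ(x')^{alg}`, the
case of `ē`) it is a theorem of the tree as of this generation: `e(A)_K = dim F(A)` for perfect `K` (Dietel (6.3.5),
`localRidgeDim_eq_dirDimOver_of_perfectField`) on both sides, and the ridge inequality `ridgeDimDropAt_of_isNearPoint`
(`…CampaignW42RidgeDimMonotone`). The imperfect case (where `e_K` can be smaller than `dim F`) is NOT claimed here.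

* `dirDimOver_add_trdeg_le_of_isNearPoint_of_perfectField` — the inequality, for `X` locally noetherian with `𝒪_{X,x}` universally
  catenary, `D` permissible at `x = π x'`, `π` a blow-up in `D`, `x'` near at some level `N`, `K` perfect (no compatibility of the two
  `K`-algebra structures is needed: both sides are ridge dimensions);
* `thm_3_10_4_of_perfectField` — the named fact's statement verbatim with `[PerfectField K]` added, proved.

NOTHING here is a statement of H. Hironaka's manuscript [Hironaka2017]. AI review is weaker than expert review. References (orientation
only): V. Cossart, U. Jannsen, S. Saito, LNM 2270 (2020), Thm. 3.10 (4); B. Dietel, Dissertation Regensburg (2015), (6.3.5), (8.2.7).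
-/

noncomputable section

-- single-conjunct summit: the doubled namespace component `ResolutionOfSingularities` is mandated
set_option linter.dupNamespace false

open CategoryTheory AlgebraicGeometry TopologicalSpace IsLocalRing
open Literature.AlgebraicGeometry.Resolution Literature.RingTheory.HilbertSamuel

namespace Summit.ResolutionOfSingularities.ResolutionOfSingularities.Theorems

namespace CampaignW42

universe u

variable {X X' : Scheme.{u}} [IsLocallyNoetherian X] [IsLocallyNoetherian X'] {π : X' ⟶ X} {D : X.IdealSheafData}

/-- **`e_{x'}(X')_K + tr.deg(κ(x')/κ(x)) ≤ e_x(X)_K` for PERFECT `K`, unconditionally** (both sides are Giraud ridge dimensions,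
`e_K = dim F` at perfect `K`; then `ridgeDimDropAt_of_isNearPoint`). [cite: CossartJannsenSaito2020, Thm. 3.10 (4)]
[cite: Dietel2015, (6.3.5), Satz (8.2.7) (ii)] -/
theorem dirDimOver_add_trdeg_le_of_isNearPoint_of_perfectField (hπ : IsBlowup π D) (x' : X')
    (hperm : IdealSheafData.IsPermissibleAt D (π.base x')) (hUC : IsUniversallyCatenaryRing (X.presheaf.stalk (π.base x')))
    {N : ℕ} (hnear : IsNearPoint π N x') (K : Type u) [Field K] [PerfectField K]
    [Algebra (ResidueField (X'.presheaf.stalk x')) K] [Algebra (ResidueField (X.presheaf.stalk (π.base x'))) K] :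
    (Scheme.dirDimOver X' x' K : Cardinal.{u}) +
        @Algebra.trdeg (X.residueField (π.base x')) (X'.residueField x') _ _ (residueAlgebra π x') ≤
      (Scheme.dirDimOver X (π.base x') K : Cardinal.{u}) := by
  have h := ridgeDimDropAt_of_isNearPoint hπ x' hperm hUC hnear
  unfold RidgeDimDropAt at h
  have h1 : Scheme.dirDimOver X' x' K = Scheme.ridgeDim X' x' :=
    (localRidgeDim_eq_dirDimOver_of_perfectField (X'.presheaf.stalk x') K).symm
  have h2 : Scheme.dirDimOver X (π.base x') K = Scheme.ridgeDim X (π.base x') :=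
    (localRidgeDim_eq_dirDimOver_of_perfectField (X.presheaf.stalk (π.base x')) K).symm
  rw [h1, h2]
  exact h

/-- **CJS Thm. 3.10 (4) for PERFECT `K` — the named fact's statement verbatim with `[PerfectField K]` added — holds unconditionally.**
(For imperfect `K` the tree keeps the binder `CossartJannsenSaito2020_thm_3_10_4`.) [cite: CossartJannsenSaito2020, Thm. 3.10 (4)]
[cite: Dietel2015, Satz (8.2.7) (ii)] -/
theorem thm_3_10_4_of_perfectField :
    ∀ (X X' : Scheme.{u}) [IsLocallyNoetherian X] [IsLocallyNoetherian X'] (π : X' ⟶ X) (D : X.IdealSheafData),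
      Scheme.IsExcellent X → IdealSheafData.IsPermissible D → IsBlowup π D →
        ∀ N : ℕ, topologicalKrullDim X ≤ (N : WithBot ℕ∞) →
          ∀ x' : X', π.base x' ∈ (D.support : Set X) → Scheme.hsFun X' N x' = Scheme.hsFun X N (π.base x') →
            ∀ (K : Type u) [Field K] [PerfectField K] [Algebra (ResidueField (X'.presheaf.stalk x')) K]
              [Algebra (ResidueField (X.presheaf.stalk (π.base x'))) K],
              (∀ a, algebraMap (ResidueField (X.presheaf.stalk (π.base x'))) K a =
                  algebraMap (ResidueField (X'.presheaf.stalk x')) K ((π.residueFieldMap x').hom a)) →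
              (Scheme.dirDimOver X' x' K : Cardinal.{u}) +
                  @Algebra.trdeg (ResidueField (X.presheaf.stalk (π.base x')))
                    (ResidueField (X'.presheaf.stalk x')) _ _ (π.residueFieldMap x').hom.toAlgebra ≤
                (Scheme.dirDimOver X (π.base x') K : Cardinal.{u}) := by
  intro X X' _ _ π D hX hD hπ N _ x' hx hnear K _ _ _ _ _
  exact dirDimOver_add_trdeg_le_of_isNearPoint_of_perfectField hπ x' (hD _ hx) (hX.isUniversallyCatenaryRing_stalk _) hnear K

end CampaignW42

end Summit.ResolutionOfSingularities.ResolutionOfSingularities.Theorems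

end
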